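/-
Copyright: statement-level skeleton of a published paper (lit-balaban cell, Phase-2 proof seat p19, gen 4). No claims beyond
what the kernel checks below.
-/
import Mathlib
import Literature.MathematicalPhysics.QuantumFieldTheory.Balaban1983to89.B3AmpIBPClosed

/-!
# B3 — T. Bałaban, *(Higgs)₂,₃ quantum fields in a finite volume. III. Renormalization*, CMP **88** (1983) 411–445
[Balaban1983Higgs3] — Sect. 2, p. 425: the integration by parts (2.8)/(2.9) carried out at ALL the (2.4)-vertices of a
graph — *"We do it for all graphs G₁, G₂^{(2)}, G₃^{(3)}, … described previously and this way we represent G′ as a sum of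
graphs {G′∗}"* — inside the amplitude model: the family of terms, in closed form, and the identity `E(G′(j)) = Σ E(G′∗(j))`

statement-level skeleton of published theorems with citation tags; proofs where landed; nothing here is a claim about
the Yang–Mills mass gap

PDF held: `paper:balaban1983-higgs-2-3-quantum-fields-finite-volume` (journal page = PDF page + 410); display (2.9) and the
sentences around it read on the ×2 render `pub-balaban/b2b-balaban-ref1/pages/1983-cmp88-higgs23-III/1983-cmp88-higgs23-III-p015-x2.png`
(p. 425).

Part of the Phase-2 work on SKELETON rows **B3.Prop2.1 / B3.Prop2.2** (unit `lit-balaban-p19` gen 4, HOME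
`run/shared/lean/pub/lit-balaban/`): the (2.4) EXCEPTION of Proposition 2.1, files `B3LatticeIBP` → `B3AmpIBP` (one
integration by parts: `rawE_site`) → `B3AmpIBPClosed` (closed form of the terms) → `B3AmpIBPAll` (this file) →
`B3AmpIBPBounds` → `B3IBPDegrees` → `B3Prop21Except24`.

WHAT IS REPRODUCED.  p. 425 [PDF 15], verbatim: *"The effect of this transformation is that the graphs (2.4) are replaced
by the graphs with degree +1. We do it for all graphs G₁, G₂^{(2)}, G₃^{(3)}, … described previously and this way we
represent G′ as a sum of graphs {G′∗}."*  KERNEL-CHECKED HERE for the raw lattice sums `rawE` of the amplitude model: given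
a set `S` of SITE LINES (each `l ∈ S` with `s(l) ≠ t(l)`; distinct site vertices `s(l)`; no site vertex an endpoint of
another site line — the situation of the single-line components `G₁, G₂^{(2)}, …` along an ordering, cf. `B3IBPDegrees`),
a direction `dir v` per vertex (the bond direction of the vertex's derivative leg, (1.8)/(1.9) p. 413) and undifferentiated
kernels `K♭_l`, such that at every site `K_l = ∂⁺_{dir s(l)}K♭_l` in the first variable and `u_{s(l)}` vanishes on the
`dir s(l)`-faces of `□(s(l))`: **`rawE_allSites`** — `E_j(u, K) = Σ_{c ∈ choices S} E_j(u_c, K_c)`, the sum over the CHOICE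
FUNCTIONS `c` (for each site: the vertex, or one of the other lines at the site vertex — the graphs G′∗), with the data of the
term `c` in the closed form of `B3AmpIBPClosed` (`allU`, `allK`).  Proof: induction on `S` with `B3AmpIBP.rawE_site`, the
sites being processed one at a time in any order — KERNEL-CHECKED first: adding a site composes its one-site transform
(`B3AmpIBP.siteU`/`siteK`) with the closed form (`allK_insert`, `allU_insert`).
-/

open Finset

namespace Literature.MathematicalPhysics.QuantumFieldTheory.Balaban1983to89.B3Ineq213

open B3Ineq215

section Insert

variable {V : Type} [DecidableEq V] {m d : ℕ} (src tgt : Fin m → V) (dir : V → Fin d) (s : ℝ) (Kb : Fin m → Ker d)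

/-! ### Adding a site: the kernels and the vertex functions -/

/-- A line untouched by the sites of `S` (not a site, no site at either endpoint) keeps its kernel.
[cite: Balaban1983Higgs3, (2.9) p.425] -/
theorem allK_untouched {S : Finset (Fin m)} (c : Fin m → Option (Fin m)) (K : Fin m → Ker d) {q : Fin m} (hq : q ∉ S)
    (hs : ∀ l ∈ S, l ≠ q → src l ≠ src q) (ht : ∀ l ∈ S, l ≠ q → src l ≠ tgt q) :
    allK src tgt dir s Kb S c K q = K q := by
  unfold allK
  rw [if_neg hq, xcode_eq_zero src c hs, ycode_eq_zero src tgt c ht]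
  simp

/-- **Adding a site composes its one-site kernel transform with the closed form.**  Hypotheses: `l₀ ∉ S`; no site of `S`
has its vertex at `s(l₀)`; no site line of `S` ends at `s(l₀)`; no site of `S` sits at `t(l₀)`; the hit line (if any)
touches `s(l₀)`. [cite: Balaban1983Higgs3, (2.9) p.425] -/
theorem allK_insert {S : Finset (Fin m)} {l₀ : Fin m} (h₀ : l₀ ∉ S) (hss : ∀ l ∈ S, src l ≠ src l₀)
    (hts : ∀ l ∈ S, tgt l ≠ src l₀) (hst : ∀ l ∈ S, src l ≠ tgt l₀) (c : Fin m → Option (Fin m)) (o : Option (Fin m))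
    (ho : ∀ p, o = some p → p ≠ l₀ ∧ (src p = src l₀ ∨ tgt p = src l₀)) (K : Fin m → Ker d) :
    allK src tgt dir s Kb (insert l₀ S) (Function.update c l₀ o) K
      = siteK src tgt l₀ (dir (src l₀)) s (Kb l₀) o (allK src tgt dir s Kb S c K) := by
  -- the closed form over `S` does not see the value of the choice at `l₀`
  have hcl : ∀ l ∈ S, Function.update c l₀ o l = c l := fun l hl =>
    Function.update_of_ne (show l ≠ l₀ from fun h => h₀ (h ▸ hl)) o c
  have hcS : allK src tgt dir s Kb S (Function.update c l₀ o) K = allK src tgt dir s Kb S c K :=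
    allK_congr src tgt dir s Kb hcl K
  funext q
  by_cases hq0 : q = l₀
  · -- the new site line itself
    subst hq0
    rw [siteK_self]
    simp [allK]
  by_cases hqS : q ∈ S
  · -- another site line: untouched by the new site
    have hL : allK src tgt dir s Kb (insert l₀ S) (Function.update c l₀ o) K q = Kb q := by
      simp [allK, hqS]
    have hR : allK src tgt dir s Kb S c K q = Kb q := by simp [allK, hqS]
    rw [hL]
    cases o with
    | none => rw [siteK_none_of_ne _ _ _ _ _ _ hq0, hR]
    | some p =>
      obtain ⟨-, hp⟩ := ho p rfl
      have hpq : q ≠ p := by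
        rintro rfl
        rcases hp with h | h
        · exact hss q hqS h
        · exact hts q hqS h
      have h1 : decide (src q = src l₀) = false := by simp [hss q hqS]
      have h2 : decide (tgt q = src l₀) = false := by simp [hts q hqS]
      have hn2 : opCode (some p) q ≠ 2 := by
        rw [opCode_some, if_neg hpq]; split_ifs <;> decide
      rw [siteK_some_of_ne _ _ _ _ _ _ hq0, hR, opOf_ap_eq_apCode, h1, h2, apCode_false_false hn2]
  -- a non-site line
  have hqS' : q ∉ insert l₀ S := by simp [hq0, hqS]
  have hxS : ∀ (c' : Fin m → Option (Fin m)), src q = src l₀ → xcode src S c' q = 0 :=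
    fun c' h => xcode_eq_zero src c' fun l hl _ => by rw [h]; exact hss l hl
  have hyS : ∀ (c' : Fin m → Option (Fin m)), tgt q = src l₀ → ycode src tgt S c' q = 0 :=
    fun c' h => ycode_eq_zero src tgt c' fun l hl _ => by rw [h]; exact hss l hl
  have hxI := xcode_insert src S (Function.update c l₀ o) l₀ q
  have hyI := ycode_insert src tgt S (Function.update c l₀ o) l₀ q
  rw [Function.update_self, xcode_congr src hcl q] at hxI
  rw [Function.update_self, ycode_congr src tgt hcl q] at hyI
  have hKq : allK src tgt dir s Kb S c K q
      = if src q = tgt q then apCode (xcode src S c q) s (dir (src q)) true true (K q)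
        else apCode (xcode src S c q) s (dir (src q)) true false
          (apCode (ycode src tgt S c q) s (dir (tgt q)) false true (K q)) := by
    unfold allK; rw [if_neg hqS]
  have hKq' : allK src tgt dir s Kb (insert l₀ S) (Function.update c l₀ o) K q
      = if src q = tgt q then
          apCode (xcode src (insert l₀ S) (Function.update c l₀ o) q) s (dir (src q)) true true (K q)
        else apCode (xcode src (insert l₀ S) (Function.update c l₀ o) q) s (dir (src q)) true false
          (apCode (ycode src tgt (insert l₀ S) (Function.update c l₀ o) q) s (dir (tgt q)) false true (K q)) := by
    unfold allK; rw [if_neg hqS']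
  rw [hKq', hxI, hyI]
  by_cases hsq : src q = src l₀
  · have hcx : (l₀ ≠ q ∧ src l₀ = src q) := ⟨Ne.symm hq0, hsq.symm⟩
    by_cases htq : tgt q = src l₀
    · -- a loop at the site vertex
      have hloop : src q = tgt q := hsq.trans htq.symm
      rw [if_pos hloop, if_pos hcx, hxS c hsq, sup_of_le_left (Nat.zero_le _)]
      cases o with
      | none => rw [siteK_none_of_ne _ _ _ _ _ _ hq0, hKq, if_pos hloop, hxS c hsq, opCode_none]
      | some p =>
        have h1 : decide (src q = src l₀) = true := by simp [hsq]
        have h2 : decide (tgt q = src l₀) = true := by simp [htq]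
        rw [siteK_some_of_ne _ _ _ _ _ _ hq0, hKq, if_pos hloop, hxS c hsq, apCode_zero, opOf_ap_eq_apCode, h1, h2, hsq]
    · -- first variable at the site vertex, second elsewhere
      have hnl : ¬ src q = tgt q := fun h => htq (h ▸ hsq)
      have hcy : ¬ (l₀ ≠ q ∧ src l₀ = tgt q) := fun h => htq h.2.symm
      rw [if_neg hnl, if_pos hcx, if_neg hcy, hxS c hsq, sup_of_le_left (Nat.zero_le _),
        sup_of_le_right (Nat.zero_le _)]
      cases o with
      | none => rw [siteK_none_of_ne _ _ _ _ _ _ hq0, hKq, if_neg hnl, hxS c hsq, opCode_none, apCode_zero]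
      | some p =>
        have h1 : decide (src q = src l₀) = true := by simp [hsq]
        have h2 : decide (tgt q = src l₀) = false := by simp [htq]
        rw [siteK_some_of_ne _ _ _ _ _ _ hq0, hKq, if_neg hnl, hxS c hsq, apCode_zero, opOf_ap_eq_apCode, h1, h2, hsq]
  · have hcx : ¬ (l₀ ≠ q ∧ src l₀ = src q) := fun h => hsq h.2.symm
    by_cases htq : tgt q = src l₀
    · -- second variable at the site vertex, first elsewhere
      have hnl : ¬ src q = tgt q := fun h => hsq (h.trans htq)
      have hcy : (l₀ ≠ q ∧ src l₀ = tgt q) := ⟨Ne.symm hq0, htq.symm⟩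
      rw [if_neg hnl, if_neg hcx, if_pos hcy, hyS c htq, sup_of_le_right (Nat.zero_le _),
        sup_of_le_left (Nat.zero_le _)]
      cases o with
      | none => rw [siteK_none_of_ne _ _ _ _ _ _ hq0, hKq, if_neg hnl, hyS c htq, opCode_none, apCode_zero]
      | some p =>
        have h1 : decide (src q = src l₀) = false := by simp [hsq]
        have h2 : decide (tgt q = src l₀) = true := by simp [htq]
        rw [siteK_some_of_ne _ _ _ _ _ _ hq0, hKq, if_neg hnl, hyS c htq, apCode_zero, opOf_ap_eq_apCode, h1, h2, htq,
          apCode_comm]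
    · -- not at the site vertex at all
      have hcy : ¬ (l₀ ≠ q ∧ src l₀ = tgt q) := fun h => htq h.2.symm
      rw [if_neg hcx, if_neg hcy, sup_of_le_right (Nat.zero_le _),
        sup_of_le_right (Nat.zero_le _)]
      cases o with
      | none => rw [siteK_none_of_ne _ _ _ _ _ _ hq0, hKq]
      | some p =>
        obtain ⟨-, hp⟩ := ho p rfl
        have hpq : q ≠ p := by
          rintro rfl
          rcases hp with h | h
          · exact hsq h
          · exact htq h
        have h1 : decide (src q = src l₀) = false := by simp [hsq]
        have h2 : decide (tgt q = src l₀) = false := by simp [htq]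
        have hn2 : opCode (some p) q ≠ 2 := by
          rw [opCode_some, if_neg hpq]; split_ifs <;> decide
        rw [siteK_some_of_ne _ _ _ _ _ _ hq0, opOf_ap_eq_apCode, h1, h2, apCode_false_false hn2, hKq]

/-- At a vertex which is not a site vertex of `S` the vertex function is unchanged. [cite: Balaban1983Higgs3, (2.9) p.425] -/
theorem allU_of_no_site {S : Finset (Fin m)} (c : Fin m → Option (Fin m)) (u : V → (Fin d → ℕ) → ℝ) {v : V}
    (h : ∀ l ∈ S, src l ≠ v) : allU src dir s S c u v = u v := by
  funext x
  unfold allU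
  rw [if_neg]
  rintro ⟨l, hl, hv⟩
  exact h l hl hv

/-- **Adding a site composes its one-site vertex transform with the closed form.** [cite: Balaban1983Higgs3, (2.9) p.425] -/
theorem allU_insert {S : Finset (Fin m)} {l₀ : Fin m} (h₀ : l₀ ∉ S) (hss : ∀ l ∈ S, src l ≠ src l₀)
    (c : Fin m → Option (Fin m)) (o : Option (Fin m)) (u : V → (Fin d → ℕ) → ℝ) :
    allU src dir s (insert l₀ S) (Function.update c l₀ o) u
      = siteU (src l₀) (dir (src l₀)) s o (allU src dir s S c u) := by
  have hcS : allU src dir s S (Function.update c l₀ o) u = allU src dir s S c u :=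
    allU_congr src dir s (fun l hl => Function.update_of_ne (show l ≠ l₀ from fun h => h₀ (h ▸ hl)) o c) u
  have hv₀ : allU src dir s S c u (src l₀) = u (src l₀) := allU_of_no_site src dir s c u hss
  funext v x
  by_cases hv : v = src l₀
  · subst hv
    have e1 : (∃ l ∈ insert l₀ S, src l = src l₀) := ⟨l₀, mem_insert_self _ _, rfl⟩
    have e2 : (∃ l ∈ insert l₀ S, src l = src l₀ ∧ Function.update c l₀ o l = none) ↔ o = none := by
      constructor
      · rintro ⟨l, hl, hsl, hcl⟩
        rcases mem_insert.1 hl with rfl | hl'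
        · rwa [Function.update_self] at hcl
        · exact absurd hsl (hss l hl')
      · intro ho
        exact ⟨l₀, mem_insert_self _ _, rfl, by rw [Function.update_self, ho]⟩
    have hL : allU src dir s (insert l₀ S) (Function.update c l₀ o) u (src l₀) x
        = o.elim (-bdiffQ s (dir (src l₀)) (u (src l₀)) x) (fun _ => -u (src l₀) (bsh (dir (src l₀)) x)) := by
      unfold allU
      rw [if_pos e1]
      cases o with
      | none => rw [if_pos (e2.2 rfl)]; rfl
      | some p => rw [if_neg (fun h => Option.some_ne_none p (e2.1 h))]; rfl
    rw [hL]
    cases o with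
    | none => rw [siteU_none_self, hv₀]; rfl
    | some p => rw [siteU_some_self, hv₀]; rfl
  · rw [siteU_of_ne _ _ _ hv, ← hcS]
    unfold allU
    have e1 : (∃ l ∈ insert l₀ S, src l = v) ↔ (∃ l ∈ S, src l = v) := by
      constructor
      · rintro ⟨l, hl, hsl⟩
        rcases mem_insert.1 hl with rfl | hl'
        · exact absurd hsl.symm hv
        · exact ⟨l, hl', hsl⟩
      · rintro ⟨l, hl, hsl⟩; exact ⟨l, mem_insert_of_mem hl, hsl⟩
    have e2 : (∃ l ∈ insert l₀ S, src l = v ∧ Function.update c l₀ o l = none)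
        ↔ (∃ l ∈ S, src l = v ∧ Function.update c l₀ o l = none) := by
      constructor
      · rintro ⟨l, hl, hsl, hcl⟩
        rcases mem_insert.1 hl with rfl | hl'
        · exact absurd hsl.symm hv
        · exact ⟨l, hl', hsl, hcl⟩
      · rintro ⟨l, hl, hsl, hcl⟩; exact ⟨l, mem_insert_of_mem hl, hsl, hcl⟩
    simp only [e1, e2]

end Insert

/-! ## The identity: `E(G′(j)) = Σ_{c} E(G′∗_c(j))` -/

section All

variable {V : Type} {m d : ℕ}

/-- The structural hypotheses on a set of site lines: every site line has two different endpoints, the site vertices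
`s(l)` are pairwise different, and no site vertex is an endpoint of another site line (the single-line components
`G₁, G₂^{(2)}, …` along an ordering are pairwise vertex-disjoint, `B3IBPDegrees`). [cite: Balaban1983Higgs3, (2.9) p.425] -/
structure IsSiteSet (src tgt : Fin m → V) (S : Finset (Fin m)) : Prop where
  /-- `s(l) ≠ t(l)` -/
  ne : ∀ l ∈ S, src l ≠ tgt l
  /-- distinct site vertices -/
  src_ne_src : ∀ l ∈ S, ∀ l' ∈ S, l ≠ l' → src l ≠ src l'
  /-- no site vertex is the far endpoint of another site line -/
  src_ne_tgt : ∀ l ∈ S, ∀ l' ∈ S, l ≠ l' → src l ≠ tgt l'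

/-- A subset of a site set is a site set. [cite: Balaban1983Higgs3, (2.9) p.425] -/
theorem IsSiteSet.mono {src tgt : Fin m → V} {S T : Finset (Fin m)} (h : IsSiteSet src tgt T) (hST : S ⊆ T) :
    IsSiteSet src tgt S :=
  ⟨fun l hl => h.ne l (hST hl), fun l hl l' hl' => h.src_ne_src l (hST hl) l' (hST hl'),
    fun l hl l' hl' => h.src_ne_tgt l (hST hl) l' (hST hl')⟩

variable [Fintype V] [DecidableEq V]

/-- **`E(G′(j)) = Σ_{G′∗} E(G′∗(j))`** — the integration by parts at all the sites.  If at every site `l ∈ S` the kernel is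
`K_l = ∂⁺_{dir s(l)} K♭_l` in the first variable and `u_{s(l)}` vanishes on the `dir s(l)`-faces of `□(s(l))`, then
`E_j(u, K) = Σ_{c ∈ choices S} E_j(allU c u, allK c K)`. [cite: Balaban1983Higgs3, (2.9) p.425] -/
theorem rawE_allSites {L k : ℕ} (hL : 0 < L) (src tgt : Fin m → V) (box : V → Fin d → ℕ) (dir : V → Fin d) (s : ℝ)
    (Kb : Fin m → Ker d) (u : V → (Fin d → ℕ) → ℝ) (K : Fin m → Ker d) (j : Fin m → ℕ) (S : Finset (Fin m))
    (hS : IsSiteSet src tgt S)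
    (hK : ∀ l ∈ S, ∀ x y, K l (j l) x y = fdiffQ s (dir (src l)) (fun x' => Kb l (j l) x' y) x)
    (hu : ∀ l ∈ S, FaceVanishing L (⟨k, box (src l)⟩ : Cube d) (dir (src l)) (u (src l))) :
    rawE L d k src tgt box u K j
      = ∑ c ∈ choices src tgt S, rawE L d k src tgt box (allU src dir s S c u) (allK src tgt dir s Kb S c K) j := by
  classical
  induction S using Finset.induction_on with
  | empty =>
    have hc : choices src tgt (∅ : Finset (Fin m)) = {fun _ => none} := by
      unfold choices
      have : opts src tgt (∅ : Finset (Fin m)) = fun _ => {none} := by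
        funext l; exact opts_of_not_mem src tgt (by simp)
      rw [this, Fintype.piFinset_singleton]
    rw [hc, sum_singleton, allU_empty, allK_empty]
  | insert l₀ S h₀ ih =>
    have hS' : IsSiteSet src tgt S := hS.mono (subset_insert _ _)
    have hl₀ : l₀ ∈ insert l₀ S := mem_insert_self _ _
    have hss : ∀ l ∈ S, src l ≠ src l₀ := fun l hl =>
      hS.src_ne_src l (mem_insert_of_mem hl) l₀ hl₀ (fun h => h₀ (h ▸ hl))
    have hts : ∀ l ∈ S, tgt l ≠ src l₀ := fun l hl =>
      (hS.src_ne_tgt l₀ hl₀ l (mem_insert_of_mem hl) (fun h => h₀ (h.symm ▸ hl))).symm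
    have hst : ∀ l ∈ S, src l ≠ tgt l₀ := fun l hl =>
      hS.src_ne_tgt l (mem_insert_of_mem hl) l₀ hl₀ (fun h => h₀ (h ▸ hl))
    rw [ih hS' (fun l hl => hK l (mem_insert_of_mem hl)) (fun l hl => hu l (mem_insert_of_mem hl))]
    -- the options at `l₀` and the product structure of the choices
    have hopts := opts_insert src tgt (S := S) h₀
    have hone : opts src tgt S l₀ = {none} := opts_of_not_mem src tgt h₀
    unfold choices
    rw [hopts, ← Literature.AlgebraicTopology.CellComplexes.CubicalTorus.sum_piFinset_update (opts src tgt S) l₀ hone]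
    refine sum_congr rfl fun c hc => ?_
    -- one more integration by parts in the term `c`
    have hKc : allK src tgt dir s Kb S c K l₀ = K l₀ :=
      allK_untouched src tgt dir s Kb c K h₀ (fun l hl _ => hss l hl) (fun l hl _ => hst l hl)
    have huc : allU src dir s S c u (src l₀) = u (src l₀) := allU_of_no_site src dir s c u hss
    have hsite := rawE_site hL src tgt box (allU src dir s S c u) (allK src tgt dir s Kb S c K) j (Kb l₀)
      (μ := dir (src l₀)) (s := s) (hS.ne l₀ hl₀)
      (fun x y => by rw [hKc]; exact hK l₀ hl₀ x y) (by rw [huc]; exact hu l₀ hl₀)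
    rw [hsite, opts_of_mem src tgt hl₀, Finset.sum_insertNone]
    have hvert := allU_insert src dir s h₀ hss c none u
    have hvertK := allK_insert src tgt dir s Kb h₀ hss hts hst c none (fun p h => (Option.some_ne_none p h.symm).elim) K
    rw [← hvert, ← hvertK]
    congr 1
    refine sum_congr rfl fun p hp => ?_
    have hp' := (mem_touching src tgt).1 hp
    rw [← allU_insert src dir s h₀ hss c (some p) u,
      ← allK_insert src tgt dir s Kb h₀ hss hts hst c (some p) (fun p' h => by cases h; exact hp') K]

/-- The same identity for an amplitude of the class `Amp`. [cite: Balaban1983Higgs3, (2.9) p.425] -/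
theorem Amp.E_allSites {M : Model V m} (A : Amp M) (dir : V → Fin M.d) (Kb : Fin m → Ker M.d) (j : Fin m → ℕ)
    (S : Finset (Fin m)) (hS : IsSiteSet M.src M.tgt S)
    (hK : ∀ l ∈ S, ∀ x y, A.K l (j l) x y = fdiffQ ((M.L : ℝ) ^ A.k) (dir (M.src l)) (fun x' => Kb l (j l) x' y) x)
    (hu : ∀ l ∈ S, FaceVanishing M.L (⟨A.k, A.box (M.src l)⟩ : Cube M.d) (dir (M.src l)) (A.u (M.src l))) :
    A.E j = ∑ c ∈ choices M.src M.tgt S, rawE M.L M.d A.k M.src M.tgt A.box (allU M.src dir ((M.L : ℝ) ^ A.k) S c A.u)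
      (allK M.src M.tgt dir ((M.L : ℝ) ^ A.k) Kb S c A.K) j := by
  rw [A.E_eq_rawE]
  exact rawE_allSites M.L_pos M.src M.tgt A.box dir _ Kb A.u A.K j S hS hK hu

end All

end Literature.MathematicalPhysics.QuantumFieldTheory.Balaban1983to89.B3Ineq213
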